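import Mathlib
import Summits.AtomisticToContinuum.FouriersLaw.Theses.BondHeatUncertainty
import Summits.AtomisticToContinuum.FouriersLaw.Theses.FeketeSeriesLaw
import Summits.AtomisticToContinuum.FouriersLaw.Theses.JunctionLocality
import Summits.AtomisticToContinuum.FouriersLaw.Theorems.BondHeatUncertaintyPositiveOrInfiniteLimit

/-!
# Route `BondHeatUncertainty` — the import slot `PositiveOrInfiniteLimit` from EVENTUAL positivity

Support for item `stmt-AtomisticToContinuum-9128`
(`Summit.AtomisticToContinuum.FouriersLaw.Theses.BondHeatUncertainty.PositiveOrInfiniteLimit`). The two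
supply lines of the companion file `BondHeatUncertaintyPositiveOrInfiniteLimit.lean` both consume
`PositiveConductance` (item 11750: `D N > 0` for EVERY `N ≥ 2`). For the LIMIT of `D N` only the tail
matters, so fixed-`N` positivity can be traded for the eventual Ohmic lower bound
`JunctionLocality.ConductanceLowerBound` (item 11749: `D N ≥ c > 0` for `N ≥ N₁`), provided Fekete's
lemma is run on the index semigroup `{n ≥ k}`, `k = max 2 N₁`, instead of `{n ≥ 2}` (the series law is
only USED at scales `≥ k`; below `k` the "resistances" `(N-1)/D N` may be junk — Lean's `x/0 = 0` — and
are never touched). Contents: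

* `iterate_subadditive_from`, `div_le_add_div_of_subadditive_from`, `tendsto_div_of_quasiSubadditive_from`
  — FEKETE'S LEMMA WITH AN ADDITIVE DEFECT ON `{n ≥ k}` (`k ≥ 1`; pure real analysis, the `k = 2` case is
  the companion's `tendsto_div_of_quasiSubadditive_two`): `a (n+m) ≤ a n + a m + C` and `a n ≥ 0` for
  `n, m ≥ k` give `a n / n → ℓ ≥ 0`.
* `ereal_tendsto_of_eventually_pos_of_tendsto_resistance_div` — the companion's `EReal` step with
  positivity of `D N` required only for `N ≥ N₁` (transfer along an eventually-equal positive sequence).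
* `ereal_tendsto_of_quasiSubadditive_resistance_of_lowerBound` — abstract THIRD LINE: the series law with
  bounded junction defect on `{N, M ≥ 2}` + an eventual lower bound `D N ≥ c > 0` ⇒ `↑(D N) → ℓ' > 0`
  (here in fact `ℓ'` is real: `R N / N ≤ 1/c`-type bounds are not needed, the `⊤` branch is simply
  allowed).
* `ereal_tendsto_of_quasiSuperadditive_resistance_of_lowerBound` — the superadditive (junction) line in
  the same spirit: series law `R N + R M - C ≤ R (N+M)` for `N, M ≥ k₀` + eventual lower bound ⇒ the
  slot's conclusion, with NO fixed-`N` positivity (the filed crux 11748 takes `PositiveConductance` as an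
  input, but the mechanism does not need it).
* `positiveOrInfiniteLimit_of_quasiSubadditive_of_lowerBound :
    FeketeSeriesLaw.QuasiSubadditiveResistance → JunctionLocality.ConductanceLowerBound →
    PositiveOrInfiniteLimit` — by name: item 9128 ⟸ 14041 ∧ 11749, WITHOUT 11750.

Nothing here closes item 9128.
-/

noncomputable section

open Filter Topology Set

namespace Summit.AtomisticToContinuum.FouriersLaw.Theorems.PositiveOrInfiniteLimit

/-! ## Fekete's lemma with an additive defect on `{n ≥ k}` -/

/-- Iterated subadditivity on the index semigroup `{n ≥ k}`: if `b (n+m) ≤ b n + b m` for `n, m ≥ k`,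
then `b (m q + r) ≤ q · b m + b r` for `m, r ≥ k` and every `q` (induction on `q`). [folklore] -/
theorem iterate_subadditive_from {b : ℕ → ℝ} {k : ℕ}
    (hb : ∀ n m : ℕ, k ≤ n → k ≤ m → b (n + m) ≤ b n + b m)
    {m r : ℕ} (hm : k ≤ m) (hr : k ≤ r) (q : ℕ) :
    b (m * q + r) ≤ (q : ℝ) * b m + b r := by
  induction q with
  | zero => simp
  | succ q ih =>
    have hqr : k ≤ m * q + r := hr.trans (Nat.le_add_left r (m * q))
    have h1 : b (m + (m * q + r)) ≤ b m + b (m * q + r) := hb m (m * q + r) hm hqr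
    have heq : m * (q + 1) + r = m + (m * q + r) := by ring
    have hmul : ((q : ℝ) + 1) * b m = (q : ℝ) * b m + b m := by ring
    rw [heq]
    push_cast
    linarith [hmul]

/-- The one-scale bound behind Fekete's lemma on `{n ≥ k}` (`k ≥ 1`): if `b` is subadditive there and
`m ≥ k`, then for some constant `M`, `b n / n ≤ b m / m + M / n` for every `n ≥ k` (Euclidean division
`n - k = m q + s`, remainder `r = s + k ∈ [k, k + m)`, `b n ≤ q b m + b r`, `q m = n - r`). [folklore] -/
theorem div_le_add_div_of_subadditive_from {b : ℕ → ℝ} {k : ℕ} (hk : 1 ≤ k)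
    (hb : ∀ n m : ℕ, k ≤ n → k ≤ m → b (n + m) ≤ b n + b m) {m : ℕ} (hm : k ≤ m) :
    ∃ M : ℝ, ∀ n : ℕ, k ≤ n → b n / (n : ℝ) ≤ b m / (m : ℝ) + M / (n : ℝ) := by
  -- a uniform bound on the finitely many remainders `b r`, `r < m + k`
  set K : ℝ := ∑ r ∈ Finset.range (m + k), |b r| with hK_def
  have hK : ∀ r : ℕ, r < m + k → b r ≤ K := fun r hr =>
    (le_abs_self _).trans
      (Finset.single_le_sum (f := fun i => |b i|) (fun i _ => abs_nonneg (b i)) (Finset.mem_range.2 hr))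
  refine ⟨((m : ℝ) + k) * |b m / (m : ℝ)| + K, fun n hn => ?_⟩
  have hm0 : 0 < m := by omega
  have hmpos : (0 : ℝ) < m := by exact_mod_cast hm0
  have hnpos : (0 : ℝ) < n := by exact_mod_cast (show 0 < n by omega)
  -- Euclidean division of `n - k` by `m`
  have hrk : k ≤ (n - k) % m + k := by omega
  have hrm : (n - k) % m + k < m + k := by
    have := Nat.mod_lt (n - k) hm0
    omega
  have hn_eq : n = m * ((n - k) / m) + ((n - k) % m + k) := by
    have := Nat.div_add_mod (n - k) m
    omega
  have hbn : b n ≤ (((n - k) / m : ℕ) : ℝ) * b m + b ((n - k) % m + k) := by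
    have := iterate_subadditive_from hb hm hrk ((n - k) / m)
    rwa [← hn_eq] at this
  have hn_real : (n : ℝ) = (m : ℝ) * (((n - k) / m : ℕ) : ℝ) + (((n - k) % m + k : ℕ) : ℝ) := by
    exact_mod_cast hn_eq
  have hR_le : (((n - k) % m + k : ℕ) : ℝ) ≤ (m : ℝ) + k := by
    exact_mod_cast (show (n - k) % m + k ≤ m + k by omega)
  have hR_nn : (0 : ℝ) ≤ (((n - k) % m + k : ℕ) : ℝ) := Nat.cast_nonneg _
  have hbr : b ((n - k) % m + k) ≤ K := hK _ hrm
  set Q : ℝ := (((n - k) / m : ℕ) : ℝ) with hQ_def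
  set R : ℝ := (((n - k) % m + k : ℕ) : ℝ) with hR_def
  set β : ℝ := b m / (m : ℝ) with hβ_def
  have hbm : b m = (m : ℝ) * β := by
    rw [hβ_def]
    field_simp
  have h1 : Q * b m = ((n : ℝ) - R) * β := by
    rw [hbm, hn_real]
    ring
  have h2 : -(R * β) ≤ R * |β| :=
    (neg_le_abs _).trans_eq (by rw [abs_mul, abs_of_nonneg hR_nn])
  have h3 : R * |β| ≤ ((m : ℝ) + k) * |β| := mul_le_mul_of_nonneg_right hR_le (abs_nonneg β)
  have hmain : b n ≤ (n : ℝ) * β + (((m : ℝ) + k) * |β| + K) := by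
    have h4 : b n ≤ ((n : ℝ) - R) * β + K := by
      rw [← h1]
      linarith [hbn, hbr]
    have h5 : ((n : ℝ) - R) * β = (n : ℝ) * β + -(R * β) := by ring
    linarith [h4, h5, h2, h3]
  calc b n / (n : ℝ) ≤ ((n : ℝ) * β + (((m : ℝ) + k) * |β| + K)) / (n : ℝ) :=
        div_le_div_of_nonneg_right hmain hnpos.le
    _ = β + (((m : ℝ) + k) * |β| + K) / (n : ℝ) := by
        rw [add_div, mul_div_cancel_left₀ β (ne_of_gt hnpos)]

/-- **Fekete's lemma with an additive defect on the index semigroup `{n ≥ k}`** (`k ≥ 1`). If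
`a (n+m) ≤ a n + a m + C` for all `n, m ≥ k` and `a n ≥ 0` for `n ≥ k`, then `a n / n` converges to
some `ℓ ≥ 0` (in fact `ℓ = inf_{n ≥ k} (a n + C)/n`). Proof: `b := a + C` is subadditive on `{n ≥ k}`
with `b n / n ≥ -|C|` there; `b n / n ≥ ℓ` for `n ≥ k` and, for every scale `m ≥ k`,
`b n / n ≤ b m / m + M/n` (`div_le_add_div_of_subadditive_from`); finally `C/n → 0`. The values of `a`
below `k` are unconstrained. [folklore] (Fekete 1923; Hammersley 1962 for the defect form) -/
theorem tendsto_div_of_quasiSubadditive_from (a : ℕ → ℝ) (C : ℝ) {k : ℕ} (hk : 1 ≤ k)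
    (hsub : ∀ n m : ℕ, k ≤ n → k ≤ m → a (n + m) ≤ a n + a m + C)
    (hpos : ∀ n : ℕ, k ≤ n → 0 ≤ a n) :
    ∃ ℓ : ℝ, 0 ≤ ℓ ∧ Tendsto (fun n : ℕ => a n / (n : ℝ)) atTop (𝓝 ℓ) := by
  -- the subadditive shift `b = a + C`
  set b : ℕ → ℝ := fun n => a n + C with hb_def
  have hb : ∀ n m : ℕ, k ≤ n → k ≤ m → b (n + m) ≤ b n + b m := by
    intro n m hn hm
    simp only [hb_def]
    linarith [hsub n m hn hm]
  have hlow : ∀ n : ℕ, k ≤ n → -|C| ≤ b n / (n : ℝ) := by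
    intro n hn
    have hn' : (1 : ℝ) ≤ n := by exact_mod_cast hk.trans hn
    have hnpos : (0 : ℝ) < n := by linarith
    rw [le_div_iff₀ hnpos]
    simp only [hb_def]
    have h1 := hpos n hn
    have h2 := neg_abs_le C
    have h3 := abs_nonneg C
    nlinarith
  -- the candidate limit `ℓ = inf_{n ≥ k} b n / n`
  set S : Set ℝ := (fun n : ℕ => b n / (n : ℝ)) '' {n : ℕ | k ≤ n} with hS_def
  have hSne : S.Nonempty := ⟨_, k, (le_rfl : k ≤ k), rfl⟩
  have hSbdd : BddBelow S := by
    refine ⟨-|C|, ?_⟩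
    rintro x ⟨n, hn, rfl⟩
    exact hlow n hn
  set ℓ := sInf S with hℓ_def
  have hℓ_le : ∀ n : ℕ, k ≤ n → ℓ ≤ b n / (n : ℝ) := fun n hn => csInf_le hSbdd ⟨n, hn, rfl⟩
  -- Step 1: `b n / n → ℓ`
  have hb_lim : Tendsto (fun n : ℕ => b n / (n : ℝ)) atTop (𝓝 ℓ) := by
    rw [tendsto_order]
    refine ⟨fun x hx => ?_, fun x hx => ?_⟩
    · filter_upwards [eventually_ge_atTop k] with n hn
      exact hx.trans_le (hℓ_le n hn)
    · have hε : 0 < (x - ℓ) / 2 := by linarith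
      obtain ⟨y, ⟨m, hm, rfl⟩, hy⟩ :=
        exists_lt_of_csInf_lt hSne (show ℓ < ℓ + (x - ℓ) / 2 by linarith)
      have hmk : k ≤ m := hm
      have hy' : b m / (m : ℝ) < ℓ + (x - ℓ) / 2 := hy
      obtain ⟨M, hM⟩ := div_le_add_div_of_subadditive_from hk hb hmk
      have hMn : ∀ᶠ n : ℕ in atTop, M / (n : ℝ) < (x - ℓ) / 2 :=
        (tendsto_const_div_atTop_nhds_zero_nat M).eventually (gt_mem_nhds hε)
      filter_upwards [hMn, eventually_ge_atTop k] with n hn hnk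
      calc b n / (n : ℝ) ≤ b m / (m : ℝ) + M / (n : ℝ) := hM n hnk
        _ < (ℓ + (x - ℓ) / 2) + (x - ℓ) / 2 := add_lt_add hy' hn
        _ = x := by ring
  -- Step 2: `a n / n = b n / n - C / n → ℓ`
  have ha_lim : Tendsto (fun n : ℕ => a n / (n : ℝ)) atTop (𝓝 ℓ) := by
    have h := hb_lim.sub (tendsto_const_div_atTop_nhds_zero_nat C)
    rw [sub_zero] at h
    refine h.congr fun n => ?_
    simp only [hb_def]
    ring
  -- Step 3: `ℓ ≥ 0`
  have hℓ0 : 0 ≤ ℓ :=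
    ge_of_tendsto ha_lim <| by
      filter_upwards [eventually_ge_atTop k] with n hn
      exact div_nonneg (hpos n hn) (Nat.cast_nonneg n)
  exact ⟨ℓ, hℓ0, ha_lim⟩

/-! ## The `EReal` step under eventual positivity -/

/-- **The `EReal` step with positivity only in the tail.** If `D N > 0` for `N ≥ N₁` and
`((N-1)/D N)/N → ℓ ≥ 0`, then `↑(D N)` converges in `EReal` to some `ℓ' > 0`. Proof: the companion's
`ereal_tendsto_of_tendsto_resistance_div` applied to the positive sequence `D'` equal to `D` from `N₁`
on and to `1` below; both the hypothesis and the conclusion only see the tail (`Tendsto.congr'`).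
[folklore] -/
theorem ereal_tendsto_of_eventually_pos_of_tendsto_resistance_div (D : ℕ → ℝ) {ℓ : ℝ} (N₁ : ℕ)
    (hpos : ∀ N : ℕ, N₁ ≤ N → 0 < D N) (hℓ0 : 0 ≤ ℓ)
    (hlim : Tendsto (fun N : ℕ => ((N : ℝ) - 1) / D N / (N : ℝ)) atTop (𝓝 ℓ)) :
    ∃ ℓ' : EReal, 0 < ℓ' ∧ Tendsto (fun N : ℕ => ((D N : ℝ) : EReal)) atTop (𝓝 ℓ') := by
  classical
  set D' : ℕ → ℝ := fun N => if N₁ ≤ N then D N else 1 with hD'_def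
  have hD'pos : ∀ N : ℕ, 2 ≤ N → 0 < D' N := by
    intro N _
    simp only [hD'_def]
    split_ifs with h
    · exact hpos N h
    · exact one_pos
  have heq : ∀ᶠ N : ℕ in atTop, D' N = D N := by
    filter_upwards [eventually_ge_atTop N₁] with N hN
    simp only [hD'_def, if_pos hN]
  have hlim' : Tendsto (fun N : ℕ => ((N : ℝ) - 1) / D' N / (N : ℝ)) atTop (𝓝 ℓ) := by
    refine hlim.congr' ?_
    filter_upwards [heq] with N hN
    rw [hN]
  obtain ⟨ℓ', hℓ', hT⟩ := ereal_tendsto_of_tendsto_resistance_div D' hD'pos hℓ0 hlim'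
  refine ⟨ℓ', hℓ', hT.congr' ?_⟩
  filter_upwards [heq] with N hN
  rw [hN]

/-! ## The third line: series law + eventual Ohmic lower bound -/

/-- **Quasi-subadditive resistance + eventual lower bound ⇒ positive-or-infinite limit** (abstract `D`).
If `D N ≥ c > 0` for `N ≥ N₁` and the "resistances" `R N := (N-1)/D N` (natural-number subtraction cast
to `ℝ`, junk where `D N ≤ 0`) satisfy `R (N+M) ≤ R N + R M + C` for all `N, M ≥ 2`, then `↑(D N)`
converges in `EReal` to some `ℓ' > 0`. Proof: on `{N ≥ k}`, `k := max 2 N₁`, `R N ≥ 0` and the series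
law holds, so Fekete on `{n ≥ k}` gives `R N / N → ℓ ≥ 0`, and the eventual `EReal` step concludes. No
fixed-`N` positivity (`PositiveConductance`) is used. [folklore] -/
theorem ereal_tendsto_of_quasiSubadditive_resistance_of_lowerBound (D : ℕ → ℝ) (C c : ℝ) (N₁ : ℕ)
    (hc : 0 < c) (hlow : ∀ N : ℕ, N₁ ≤ N → c ≤ D N)
    (hsub : ∀ N M : ℕ, 2 ≤ N → 2 ≤ M →
      ((N + M - 1 : ℕ) : ℝ) / D (N + M) ≤ ((N - 1 : ℕ) : ℝ) / D N + ((M - 1 : ℕ) : ℝ) / D M + C) :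
    ∃ ℓ : EReal, 0 < ℓ ∧ Tendsto (fun N : ℕ => ((D N : ℝ) : EReal)) atTop (𝓝 ℓ) := by
  have hpos : ∀ N : ℕ, N₁ ≤ N → 0 < D N := fun N hN => hc.trans_le (hlow N hN)
  -- the resistances `a N = (N-1)/D N`, nonnegative and quasi-subadditive from `k = max 2 N₁` on
  set k : ℕ := max 2 N₁ with hk_def
  have hk1 : 1 ≤ k := le_trans (by norm_num) (le_max_left 2 N₁)
  set a : ℕ → ℝ := fun N => ((N - 1 : ℕ) : ℝ) / D N with ha_def
  have ha_sub : ∀ n m : ℕ, k ≤ n → k ≤ m → a (n + m) ≤ a n + a m + C := fun n m hn hm => by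
    simpa only [ha_def] using
      hsub n m ((le_max_left 2 N₁).trans hn) ((le_max_left 2 N₁).trans hm)
  have ha_pos : ∀ n : ℕ, k ≤ n → 0 ≤ a n := fun n hn =>
    div_nonneg (Nat.cast_nonneg _) (hpos n ((le_max_right 2 N₁).trans hn)).le
  obtain ⟨ℓ, hℓ0, hlim⟩ := tendsto_div_of_quasiSubadditive_from a C hk1 ha_sub ha_pos
  refine ereal_tendsto_of_eventually_pos_of_tendsto_resistance_div D N₁ hpos hℓ0 (hlim.congr' ?_)
  filter_upwards [eventually_ge_atTop 1] with N hN
  simp only [ha_def]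
  rw [Nat.cast_sub hN, Nat.cast_one]

/-- **Quasi-superadditive resistance (at large scales) + eventual lower bound ⇒ positive-or-infinite
limit** (abstract `D`; the companion's `ereal_tendsto_of_quasiSuperadditive_resistance` WITHOUT its
fixed-`N` positivity hypothesis and with the series law only required for `N, M ≥ k₀`). If `D N ≥ c > 0`
for `N ≥ N₁` and `R N := (N-1)/D N` satisfies `R N + R M - C ≤ R (N+M)` for `N, M ≥ k₀`, then `↑(D N)`
converges in `EReal` to some `ℓ' > 0`. Proof: `R N ≤ N/c + K₀` for all `N ≥ 1` (`K₀` absorbing the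
finitely many `N < N₁`, where NO sign information on `D N` is used: `R N ≤ |R N|`), so
`a N := N/c + K₀ - R N ≥ 0` is quasi-SUBadditive on `{N ≥ max 1 k₀}`; Fekete on that semigroup gives
`a N / N → ℓₐ`, hence `R N / N → 1/c - ℓₐ =: ℓ ≥ 0` (sign from the tail `N ≥ N₁`), and the eventual
`EReal` step concludes. So the junction line, too, needs positivity of `D N` only in the tail — the filed
crux `JunctionLocality.SuperadditiveResistance` (item 11748) merely happens to take `PositiveConductance`
as an input. [folklore] -/
theorem ereal_tendsto_of_quasiSuperadditive_resistance_of_lowerBound (D : ℕ → ℝ) (C c : ℝ) (N₁ k₀ : ℕ)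
    (hc : 0 < c) (hlow : ∀ N : ℕ, N₁ ≤ N → c ≤ D N)
    (hsup : ∀ N M : ℕ, k₀ ≤ N → k₀ ≤ M →
      ((N : ℝ) - 1) / D N + ((M : ℝ) - 1) / D M - C ≤ ((N : ℝ) + (M : ℝ) - 1) / D (N + M)) :
    ∃ ℓ : EReal, 0 < ℓ ∧ Tendsto (fun N : ℕ => ((D N : ℝ) : EReal)) atTop (𝓝 ℓ) := by
  have hpos : ∀ N : ℕ, N₁ ≤ N → 0 < D N := fun N hN => hc.trans_le (hlow N hN)
  set R : ℕ → ℝ := fun N => ((N : ℝ) - 1) / D N with hR_def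
  -- `R N ≤ N/c + K₀` for every `N ≥ 1`
  set K₀ : ℝ := ∑ N ∈ Finset.range N₁, |R N| with hK₀_def
  have hK₀ : 0 ≤ K₀ := Finset.sum_nonneg fun i _ => abs_nonneg (R i)
  have hRle : ∀ N : ℕ, 1 ≤ N → R N ≤ (N : ℝ) / c + K₀ := by
    intro N hN
    have hNc : 0 ≤ (N : ℝ) / c := div_nonneg (Nat.cast_nonneg N) hc.le
    rcases lt_or_ge N N₁ with h | h
    · calc R N ≤ |R N| := le_abs_self _
        _ ≤ K₀ := Finset.single_le_sum (f := fun i => |R i|) (fun i _ => abs_nonneg (R i))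
            (Finset.mem_range.2 h)
        _ ≤ (N : ℝ) / c + K₀ := by linarith
    · have hD : c ≤ D N := hlow N h
      have hN1 : (0 : ℝ) ≤ (N : ℝ) - 1 := by
        have : (1 : ℝ) ≤ N := by exact_mod_cast hN
        linarith
      calc R N = ((N : ℝ) - 1) / D N := rfl
        _ ≤ ((N : ℝ) - 1) / c := div_le_div_of_nonneg_left hN1 hc hD
        _ ≤ (N : ℝ) / c := div_le_div_of_nonneg_right (by linarith) hc.le
        _ ≤ (N : ℝ) / c + K₀ := by linarith
  -- the quasi-subadditive complement `a N = N/c + K₀ - R N ≥ 0` on `{N ≥ k}`, `k := max 1 k₀`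
  set k : ℕ := max 1 k₀ with hk_def
  have hk1 : 1 ≤ k := le_max_left 1 k₀
  set a : ℕ → ℝ := fun N => (N : ℝ) / c + K₀ - R N with ha_def
  have ha_pos : ∀ n : ℕ, k ≤ n → 0 ≤ a n := fun n hn => by
    simp only [ha_def]
    linarith [hRle n (hk1.trans hn)]
  have ha_sub : ∀ n m : ℕ, k ≤ n → k ≤ m → a (n + m) ≤ a n + a m + (C - K₀) := by
    intro n m hn hm
    have h := hsup n m ((le_max_right 1 k₀).trans hn) ((le_max_right 1 k₀).trans hm)
    have hRnm : R (n + m) = ((n : ℝ) + (m : ℝ) - 1) / D (n + m) := by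
      simp only [hR_def, Nat.cast_add]
    simp only [ha_def, Nat.cast_add]
    rw [hRnm]
    rw [(rfl : R n = ((n : ℝ) - 1) / D n), (rfl : R m = ((m : ℝ) - 1) / D m)]
    linarith [add_div (n : ℝ) (m : ℝ) c]
  obtain ⟨ℓa, -, hlim⟩ := tendsto_div_of_quasiSubadditive_from a (C - K₀) hk1 ha_sub ha_pos
  -- `R N / N = 1/c + K₀/N - a N/N → 1/c - ℓa =: ℓ ≥ 0`
  have hRlim : Tendsto (fun N : ℕ => ((N : ℝ) - 1) / D N / (N : ℝ)) atTop (𝓝 (1 / c + 0 - ℓa)) := by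
    have h := ((tendsto_const_nhds (x := 1 / c)).add (tendsto_const_div_atTop_nhds_zero_nat K₀)).sub hlim
    refine h.congr' ?_
    filter_upwards [eventually_ge_atTop 1] with N hN
    have hN0 : (N : ℝ) ≠ 0 := by exact_mod_cast (show N ≠ 0 by omega)
    simp only [ha_def, hR_def]
    field_simp
    ring
  have hℓ0 : 0 ≤ 1 / c + 0 - ℓa :=
    ge_of_tendsto hRlim <| by
      filter_upwards [eventually_ge_atTop (max 1 N₁)] with N hN
      have hN1 : (0 : ℝ) ≤ (N : ℝ) - 1 := by
        have : (1 : ℝ) ≤ N := by exact_mod_cast (le_max_left 1 N₁).trans hN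
        linarith
      exact div_nonneg (div_nonneg hN1 (hpos N ((le_max_right 1 N₁).trans hN)).le) (Nat.cast_nonneg N)
  exact ereal_tendsto_of_eventually_pos_of_tendsto_resistance_div D N₁ hpos hℓ0 hRlim

open Summit.AtomisticToContinuum.FouriersLaw.Theses in
/-- **`QuasiSubadditiveResistance → ConductanceLowerBound → PositiveOrInfiniteLimit`** (route decls of
`FeketeSeriesLaw` and `JunctionLocality` by name; conclusion the route decl of `BondHeatUncertainty`):
item 9128 from items 14041 and 11749 alone — the eventual Ohmic lower bound replaces fixed-`N` positive
conductance (item 11750) in the Fekete supply line. Fix the parameters, the weak-NESS uniqueness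
hypothesis, a steady-state family `μ`, `T > 0` and response coefficients `D`; the two cruxes give the
series law with bounded junction defect and `D N ≥ c > 0` for `N ≥ N₁`, and
`ereal_tendsto_of_quasiSubadditive_resistance_of_lowerBound` concludes. Does not close item 9128.
[folklore] -/
theorem positiveOrInfiniteLimit_of_quasiSubadditive_of_lowerBound
    (hS : FeketeSeriesLaw.QuasiSubadditiveResistance) (hL : JunctionLocality.ConductanceLowerBound) :
    BondHeatUncertainty.PositiveOrInfiniteLimit := by
  intro ω₂ lam β γ hω hl hβ hγ huniq μ hμ T hT D hD
  obtain ⟨C, hC⟩ := hS ω₂ lam β γ hω hl hβ hγ huniq μ hμ T hT D hD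
  obtain ⟨c, hc, N₁, hN₁⟩ := hL ω₂ lam β γ hω hl hβ hγ huniq μ hμ T hT D hD
  exact ereal_tendsto_of_quasiSubadditive_resistance_of_lowerBound D C c N₁ hc hN₁ hC

end Summit.AtomisticToContinuum.FouriersLaw.Theorems.PositiveOrInfiniteLimit

end
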